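import Summits.ResolutionOfSingularities.ResolutionOfSingularities.Theorems.PurelyInseparableDim4ResConeCornerWalls
import Summits.ResolutionOfSingularities.ResolutionOfSingularities.Theorems.PurelyInseparableDim4ResConeSatChain
import Summits.ResolutionOfSingularities.ResolutionOfSingularities.Theorems.PurelyInseparableDim4WindowGame
import Summits.ResolutionOfSingularities.ResolutionOfSingularities.Theorems.PurelyInseparableDim4FreeTailLemma
import HarnessLib
import HarnessLib.Audit.Tags

/-!
# Purely inseparable four-folds — NO PURE-CORNER COORDINATE-FRAME TRAP: the kernel core of idea-4's T33e2/T43e2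
# (CARD I-4-8 §A–§C) with the W-frame as HYPOTHESES — polyhedron transport + isolation window + vertex lemma +
# the free-tail theorem (K2(p) lane, SLICE C (C6), file-holder res-dim4-p-5 g3)

[OURS · counted 0 · cell `res-dim4-pi` · K2(p) lane (desk WORDS #78 (d), #80 (d)) · seat res-dim4-p-5 g3.]
Nothing here proves K2(p), `NoIsolatedTrap p p` or resolution of singularities in dimension ≥ 4 /
characteristic `p`; the frame hypotheses below are exactly what brick (ii) (Tschirnhaus / W-frame, p-1 g2 /
p-11 g2) plus a transfer lemma must produce from a constant-`(d, e_G = 2)` tail of idea-4's classes A∞ / C∞.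

THE THEOREM (`no_pureCorner_frame_chain`, every prime `p`, every field of characteristic `p`).  There is no
witnessed `Step0 p` chain `(c, j, b)` of ISOLATED above-floor states with `x^{r₀} ∣ F₀` and constant natural shade
`d` such that, for two letters `a ≠ a′`, every step is a PURE CORNER (`b k = 0`) in chart `a` or `a′`, every
residual cone `resForm (c k)` is free of `x_a, x_{a′}` (for `d < p`: `e_a, e_{a′} ∈ resVertex (c k)` —
`no_pureCorner_frame_chain_of_single_mem`), and the active letters stay LIGHT:
`r_k(a) + r_k(a′) ≤ 2 · r_{k+1}(j k)` (twice the multiplicity of the component created by the step).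
`no_pureCorner_frame_tail` is the same for a chain acquiring these properties from some index `k₀` on.

PROOF (I-4-8 §A–§C).  Index the generating points of Hironaka's polygon `Δ(G₀; x_a, x_{a′}; x_P)` by the monomials
`x^e` of `F₀` of positive LEVEL `n_e = d − |e − r₀|_P` (`P = univ ∖ {a, a′}`), and move each formally by the
corner word (`cornerTraj`: `f ↦ f.update (j t) (|f| − d)`, `…ResConeCornerTransport`): on the active pair this
is `…WindowGame`'s `T_a / T_b` with denominator `n_e` (`cornerTraj_pair_succ`).  NO BIRTHS
(`exists_ancestor`): every monomial of `F_t` is `x^{r_t + cornerTraj … t}` for a monomial of `F₀` whose whole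
ancestry is alive.  LOWER WALL (`…CornerWalls`): alive ⇒ `σ > 1`.  UPPER WALL: the child of step `t` is isolated
and the letters are light ⇒ some monomial alive at `t` has `σ < 2`.  Hence
`WindowGame.eventually_constant_of_window_local` makes the chart word eventually constant — an infinite run of
pure-corner REPEATS, i.e. no satellite step after some index — and the tree's free-tail theorem
`FreeTailProof.noIsolatedFreeTailAt_self` produces a non-isolated state: contradiction.
[cite: CossartJannsenSaito2020, Lemma 12.3, Lemma 13.2, Lemma 13.4, Thm. 13.7]
bears_on: LADDER-RESOLUTION:D157-DOOR2 (res-dim4-pi · K2(p) = `RidgeBudget.NoAboveFloorTrap p p` · slice C).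
Supports stmt-ResolutionOfSingularities-16155 (helper).
-/

set_option linter.dupNamespace false -- mandated namespace of this single-conjunct summit

noncomputable section

namespace Summit.ResolutionOfSingularities.ResolutionOfSingularities.Theorems.PIDim4

namespace ResCone

open MvPolynomial Finset
open Literature.AlgebraicGeometry.Resolution
open Literature.AlgebraicGeometry.Resolution.CentreBlowup
open Literature.AlgebraicGeometry.Resolution.Hauser2010
open Literature.AlgebraicGeometry.Resolution.HauserPerlega2019

variable {K : Type} [Field K]

/-! ## 1. The formal corner trajectory of a residual exponent -/

/-- The FORMAL trajectory of a residual exponent under the corner word `j`: `f_{t+1} = f_t.update (j t) (|f_t| − d)`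
(Hironaka's corner map of the chart `j t`, `…ResConeCornerTransport`), defined for all times whether or not the
monomial survives the cleanings. [cite: CossartJannsenSaito2020, Lemma 13.2, Lemma 13.4] -/
def cornerTraj (j : ℕ → Fin 4) (d : ℕ) (f₀ : Fin 4 →₀ ℕ) : ℕ → (Fin 4 →₀ ℕ)
  | 0 => f₀
  | t + 1 => (cornerTraj j d f₀ t).update (j t) ((cornerTraj j d f₀ t).degree - d)

/-- Unfolding at time `0`. [folklore] -/
theorem cornerTraj_zero (j : ℕ → Fin 4) (d : ℕ) (f₀ : Fin 4 →₀ ℕ) : cornerTraj j d f₀ 0 = f₀ := rfl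

/-- Unfolding at time `t + 1`. [folklore] -/
theorem cornerTraj_succ (j : ℕ → Fin 4) (d : ℕ) (f₀ : Fin 4 →₀ ℕ) (t : ℕ) :
    cornerTraj j d f₀ (t + 1) = (cornerTraj j d f₀ t).update (j t) ((cornerTraj j d f₀ t).degree - d) := rfl

/-- On a word in the two letters `a, a′` the passive degree is constant along the trajectory (the LEVEL of the
generating point is kept). [cite: CossartJannsenSaito2020, Lemma 13.2] -/
theorem degIn_passive_cornerTraj {j : ℕ → Fin 4} {a a' : Fin 4} (hj : ∀ t, j t = a ∨ j t = a') (d : ℕ)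
    (f₀ : Fin 4 →₀ ℕ) (t : ℕ) :
    degIn ((Finset.univ.erase a).erase a') (cornerTraj j d f₀ t) = degIn ((Finset.univ.erase a).erase a') f₀ := by
  induction t with
  | zero => rfl
  | succ t ih => rw [cornerTraj_succ, degIn_passive_update (hj t), ih]

/-- **The active pair moves by `T_a / T_{a′}`** (numerators over the level `n = d − |f₀|_P`, `|f₀|_P ≤ d`):
the step equation of `…WindowGame` for the word `w t = (j t = a)`. [cite: CossartJannsenSaito2020, Lemma 13.2, Lemma 13.4] -/
theorem cornerTraj_pair_succ {j : ℕ → Fin 4} {a a' : Fin 4} (haa : a ≠ a') (hj : ∀ t, j t = a ∨ j t = a')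
    (d : ℕ) (f₀ : Fin 4 →₀ ℕ) (hP : degIn ((Finset.univ.erase a).erase a') f₀ ≤ d) (t : ℕ) :
    ((cornerTraj j d f₀ (t + 1)) a, (cornerTraj j d f₀ (t + 1)) a') =
      if j t = a then
        ((cornerTraj j d f₀ t) a + (cornerTraj j d f₀ t) a' - (d - degIn ((Finset.univ.erase a).erase a') f₀),
          (cornerTraj j d f₀ t) a')
      else ((cornerTraj j d f₀ t) a,
        (cornerTraj j d f₀ t) a + (cornerTraj j d f₀ t) a' - (d - degIn ((Finset.univ.erase a).erase a') f₀)) := by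
  have hPt : degIn ((Finset.univ.erase a).erase a') (cornerTraj j d f₀ t) ≤ d := by
    rw [degIn_passive_cornerTraj hj]; exact hP
  rw [cornerTraj_succ, ← degIn_passive_cornerTraj hj d f₀ t]
  rcases hj t with h | h
  · rw [if_pos h, h, update_apply_chart haa _ hPt, update_apply_other haa]
  · have hne : j t ≠ a := by rw [h]; exact haa.symm
    rw [if_neg hne, h, update_apply_chart' haa _ hPt, update_apply_other haa.symm]

/-! ## 2. The chain: band data, the pure-corner step, no births -/

/-- Natural residual degree along a constant-shade chain: `o_k − |r_k| = d`. [folklore] -/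
theorem ordZero_sub_degree_eq_of_shade {s : State K} {o d : ℕ} (ho : ordZero s.F = o)
    (hshade : s.shade = (d : ℕ∞)) : o - s.r.degree = d := by
  rw [BandShade.shade_eq_coe ho] at hshade
  exact_mod_cast hshade

section Chain

variable (p : ℕ) [Fact p.Prime] [DecidableEq K]

omit [Fact p.Prime] in
/-- The witnessed step at a pure corner: `c (k+1) = step p univ (j k) 0 (c k)`. [folklore] -/
theorem chain_succ_eq_step_zero {c : ℕ → State K} {j : ℕ → Fin 4} {b : ℕ → Fin 4 → K}
    (hw : FreeTail.IsWitnessedChain p c j b) (hcorner : ∀ k, b k = 0) (k : ℕ) :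
    c (k + 1) = CentreBlowup.step p Finset.univ (j k) 0 (c k) := by
  rw [(hw k).2.2.2.2, hcorner k]

/-- **NO BIRTHS along a pure-corner chain**: every monomial of `F_t` is `x^{r_t + f_t}` where `f_t` is the formal
corner trajectory at time `t` of the residual exponent of a monomial of `F₀`, ALL of whose intermediate positions
are alive. [cite: CossartJannsenSaito2020, Lemma 13.2] -/
theorem exists_ancestor {c : ℕ → State K} {j : ℕ → Fin 4} {b : ℕ → Fin 4 → K}
    (hc : ∀ k, IsIsolated p (c k).F ∧ Step0 p (c k) (c (k + 1))) (hw : FreeTail.IsWitnessedChain p c j b)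
    (hr0 : ∀ e ∈ (c 0).F.support, (c 0).r ≤ e) (hfloor : ∀ k, ordZero (c k).F ≠ p) {d : ℕ}
    (hshade : ∀ k, (c k).shade = (d : ℕ∞)) (hcorner : ∀ k, b k = 0) (t : ℕ) :
    ∀ E ∈ (c t).F.support, ∃ e ∈ (c 0).F.support,
      (∀ t', t' ≤ t → (c t').r + cornerTraj j d (e - (c 0).r) t' ∈ (c t').F.support) ∧
        cornerTraj j d (e - (c 0).r) t = E - (c t).r := by
  induction t with
  | zero =>
    intro E hE
    refine ⟨E, hE, fun t' ht' => ?_, rfl⟩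
    obtain rfl : t' = 0 := Nat.le_zero.mp ht'
    rw [cornerTraj_zero, add_tsub_cancel_of_le (hr0 E hE)]
    exact hE
  | succ t ih =>
    intro E hE
    obtain ⟨o, ho, hpo, -⟩ := chain_band p hc hfloor t
    have hrt := IsolatedBand.isolated_chain_forall_le hc hr0 t
    have hstep := chain_succ_eq_step_zero p hw hcorner t
    rw [hstep] at hE
    obtain ⟨E₀, hE₀, hχ⟩ := exists_of_mem_support_step_zero (j t) (c t) hE
    obtain ⟨e, he, hanc, htr⟩ := ih E₀ hE₀
    have hd : o - (c t).r.degree = d := ordZero_sub_degree_eq_of_shade ho (hshade t)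
    have hnew : cornerTraj j d (e - (c 0).r) (t + 1) = E - (c (t + 1)).r := by
      rw [cornerTraj_succ, htr, hstep, ← hχ, sub_step_zero_r_eq p (j t) (c t) ho hrt hpo.le hE₀, hd]
    refine ⟨e, he, fun t' ht' => ?_, hnew⟩
    rcases Nat.lt_or_ge t' (t + 1) with hlt | hge
    · exact hanc t' (Nat.lt_succ_iff.mp hlt)
    · obtain rfl : t' = t + 1 := le_antisymm ht' hge
      rw [hnew, add_tsub_cancel_of_le, hstep]
      · exact hE
      · rw [hstep, ← hχ]
        exact step_zero_r_le_chartExponent p (j t) (c t) ho hrt hpo.le hE₀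

/-! ## 3. The theorem -/

/-- **NO PURE-CORNER COORDINATE-FRAME TRAP** (the kernel core of idea-4's T33e2/T43e2, every prime): no witnessed
`Step0 p` chain of isolated above-floor states with `x^{r₀} ∣ F₀` and constant natural shade `d` runs for ever by
PURE CORNERS in two charts `a ≠ a′` with the residual cone free of `x_a, x_{a′}` at every state and light active
letters `r_k(a) + r_k(a′) ≤ 2 r_{k+1}(j k)`. [OURS] [cite: CossartJannsenSaito2020, Lemma 12.3, Lemma 13.2, Thm. 13.7] -/
theorem no_pureCorner_frame_chain [CharP K p] {c : ℕ → State K} {j : ℕ → Fin 4} {b : ℕ → Fin 4 → K}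
    (hc : ∀ k, IsIsolated p (c k).F ∧ Step0 p (c k) (c (k + 1))) (hw : FreeTail.IsWitnessedChain p c j b)
    (hr0 : ∀ e ∈ (c 0).F.support, (c 0).r ≤ e) (hfloor : ∀ k, ordZero (c k).F ≠ p) {d : ℕ}
    (hshade : ∀ k, (c k).shade = (d : ℕ∞)) {a a' : Fin 4} (haa : a ≠ a') (hcorner : ∀ k, b k = 0)
    (hletters : ∀ k, j k = a ∨ j k = a')
    (hfree : ∀ k, ∀ μ ∈ (resForm (c k)).support, μ a = 0 ∧ μ a' = 0)
    (hlight : ∀ k, (c k).r a + (c k).r a' ≤ 2 * (c (k + 1)).r (j k)) : False := by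
  classical
  -- notation
  set P : Finset (Fin 4) := (Finset.univ.erase a).erase a' with hPdef
  set r₀ := (c 0).r with hr₀
  have hrk : ∀ k, ∀ e ∈ (c k).F.support, (c k).r ≤ e := IsolatedBand.isolated_chain_forall_le hc hr0
  have hstep : ∀ k, c (k + 1) = CentreBlowup.step p Finset.univ (j k) 0 (c k) :=
    chain_succ_eq_step_zero p hw hcorner
  -- the generating points: monomials of `F₀` of positive level
  let ι : Type := ↥((c 0).F.support.filter fun e => degIn P (e - r₀) < d)
  let n : ι → ℕ := fun i => d - degIn P (i.1 - r₀)
  let tr : ι → ℕ → (Fin 4 →₀ ℕ) := fun i t => cornerTraj j d (i.1 - r₀) t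
  let qq : ι → ℕ → ℕ × ℕ := fun i t => ((tr i t) a, (tr i t) a')
  let w : ℕ → Bool := fun t => decide (j t = a)
  have hιmem : ∀ i : ι, i.1 ∈ (c 0).F.support ∧ degIn P (i.1 - r₀) < d := fun i =>
    Finset.mem_filter.mp i.2
  -- the step equation of the window game
  have hstepq : ∀ i t, qq i (t + 1) =
      if w t then ((qq i t).1 + (qq i t).2 - n i, (qq i t).2)
      else ((qq i t).1, (qq i t).1 + (qq i t).2 - n i) := by
    intro i t
    have h := cornerTraj_pair_succ haa hletters d (i.1 - r₀) (hιmem i).2.le t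
    by_cases hjt : j t = a
    · simp only [qq, tr, n, w, hjt, decide_true, if_true] at h ⊢
      exact h
    · simp only [qq, tr, n, w, hjt, decide_false, if_false, Bool.false_eq_true] at h ⊢
      exact h
  -- the witness at time `t`: upper wall at the step `t`, pulled back to `F₀` (no births), legal along its past
  have hwit : ∀ t, ∃ i, (∀ t', t' ≤ t → n i < (qq i t').1 + (qq i t').2) ∧
      (qq i t).1 + (qq i t).2 < 2 * n i := by
    intro t
    obtain ⟨o, ho, hpo, -⟩ := chain_band p hc hfloor t
    have hd : o - (c t).r.degree = d := ordZero_sub_degree_eq_of_shade ho (hshade t)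
    have hiso : IsIsolated p (CentreBlowup.step p Finset.univ (j t) 0 (c t)).F := by
      rw [← hstep t]; exact (hc (t + 1)).1
    have hlt : (c t).r a + (c t).r a' + 2 * p ≤ 2 * o := by
      have h1 := hlight t
      rw [hstep t, step_zero_r p (j t) (c t) ho (hrk t), Finsupp.update_apply, if_pos rfl] at h1
      omega
    -- the upper wall in the chart of the step, written with the passive set `P`
    have hwall : ∃ E ∈ (c t).F.support,
        (E - (c t).r) a + (E - (c t).r) a' + 2 * degIn P (E - (c t).r) < 2 * d := by
      rcases hletters t with hja | hja'
      · rw [hja] at hiso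
        obtain ⟨E, hE, -, hElt⟩ := exists_apply_add_apply_lt_two_mul_level p haa (c t) ho (hrk t) hpo.le hiso
          hlt
        exact ⟨E, hE, by rw [hd] at hElt; exact hElt⟩
      · rw [hja'] at hiso
        obtain ⟨E, hE, -, hElt⟩ := exists_apply_add_apply_lt_two_mul_level p haa.symm (c t) ho (hrk t) hpo.le
          hiso (by omega)
        refine ⟨E, hE, ?_⟩
        rw [hd, Finset.erase_right_comm, ← hPdef] at hElt
        omega
    obtain ⟨E, hE, hElt⟩ := hwall
    obtain ⟨e, he, hanc, htr⟩ := exists_ancestor p hc hw hr0 hfloor hshade hcorner t E hE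
    have hpass : degIn P (e - r₀) = degIn P (E - (c t).r) := by
      rw [← htr, degIn_passive_cornerTraj hletters]
    have hlev : degIn P (e - r₀) < d := by rw [hpass]; omega
    refine ⟨⟨e, Finset.mem_filter.mpr ⟨he, hlev⟩⟩, fun t' ht' => ?_, ?_⟩
    · -- legality along the past: the ancestor at time `t'` is alive, lower wall at `t'`
      obtain ⟨o', ho', -, -⟩ := chain_band p hc hfloor t'
      have hd' : o' - (c t').r.degree = d := ordZero_sub_degree_eq_of_shade ho' (hshade t')
      have halive := hanc t' ht'
      have hsub : (c t').r + cornerTraj j d (e - r₀) t' - (c t').r = cornerTraj j d (e - r₀) t' :=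
        add_tsub_cancel_left _ _
      have hlow := apply_add_apply_gt_level_of_free ho' (hrk t') haa (hfree t') halive (by
        rw [hsub, degIn_passive_cornerTraj hletters, hd']; exact hlev)
      rw [hsub, degIn_passive_cornerTraj hletters, hd'] at hlow
      change d - degIn P (e - r₀) < (cornerTraj j d (e - r₀) t') a + (cornerTraj j d (e - r₀) t') a'
      exact hlow
    · change (cornerTraj j d (e - r₀) t) a + (cornerTraj j d (e - r₀) t) a' < 2 * (d - degIn P (e - r₀))
      rw [htr]
      omega
  -- the vertex lemma: the chart word is eventually constant …
  obtain ⟨T, cb, hT⟩ := WindowGame.eventually_constant_of_window_local n w qq hstepq hwit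
  -- … so no satellite step occurs after `T` …
  have hnosat : ∀ k, T ≤ k → ¬ FreeTail.IsSatellite j b k := by
    intro k hk hsat
    apply hsat.1
    have hiff : (j k = a ↔ j (k + 1) = a) := by
      have h12 : w k = w (k + 1) := by rw [hT k hk, hT (k + 1) (by omega)]
      simpa [w] using h12
    rcases hletters k with hk' | hk'
    · rw [hk', hiff.mp hk']
    · rcases hletters (k + 1) with hk1 | hk1
      · exact absurd (hiff.mpr hk1) (by rw [hk']; exact haa.symm)
      · rw [hk', hk1]
  -- … and the free-tail theorem produces a non-isolated state
  obtain ⟨k, hk⟩ := FreeTailProof.noIsolatedFreeTailAt_self p K c j b T hw hnosat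
  exact hk (hc k).1

/-- The same with the polar-kernel hypothesis of the W-frame (`e_a, e_{a′} ∈ resVertex (c k)`) in the TAME range
`d < p`. [OURS] [cite: CossartJannsenSaito2020, Def. 2.8, Lemma 13.2, Thm. 13.7] -/
theorem no_pureCorner_frame_chain_of_single_mem [CharP K p] {c : ℕ → State K} {j : ℕ → Fin 4}
    {b : ℕ → Fin 4 → K} (hc : ∀ k, IsIsolated p (c k).F ∧ Step0 p (c k) (c (k + 1)))
    (hw : FreeTail.IsWitnessedChain p c j b) (hr0 : ∀ e ∈ (c 0).F.support, (c 0).r ≤ e)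
    (hfloor : ∀ k, ordZero (c k).F ≠ p) {d : ℕ} (hdp : d < p) (hshade : ∀ k, (c k).shade = (d : ℕ∞))
    {a a' : Fin 4} (haa : a ≠ a') (hcorner : ∀ k, b k = 0) (hletters : ∀ k, j k = a ∨ j k = a')
    (hvertex : ∀ k, (Pi.single a 1 : Fin 4 → K) ∈ resVertex (c k) ∧
      (Pi.single a' 1 : Fin 4 → K) ∈ resVertex (c k))
    (hlight : ∀ k, (c k).r a + (c k).r a' ≤ 2 * (c (k + 1)).r (j k)) : False := by
  refine no_pureCorner_frame_chain p hc hw hr0 hfloor hshade haa hcorner hletters (fun k => ?_) hlight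
  obtain ⟨o, ho, -, -⟩ := chain_band p hc hfloor k
  have hd : o - (c k).r.degree = d := ordZero_sub_degree_eq_of_shade ho (hshade k)
  exact free_of_single_mem_resVertex p ho (by rw [hd]; exact hdp) (hvertex k).1 (hvertex k).2

/-- **TAIL FORM**: no isolated above-floor `Step0 p` chain with `x^{r₀} ∣ F₀` acquires, from some index `k₀` on,
a constant natural shade together with a pure-corner two-letter coordinate frame with light active letters.
[OURS] [cite: CossartJannsenSaito2020, Lemma 12.3, Lemma 13.2, Thm. 13.7] -/
theorem no_pureCorner_frame_tail [CharP K p] {c : ℕ → State K} {j : ℕ → Fin 4} {b : ℕ → Fin 4 → K}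
    (hc : ∀ k, IsIsolated p (c k).F ∧ Step0 p (c k) (c (k + 1))) (hw : FreeTail.IsWitnessedChain p c j b)
    (hr0 : ∀ e ∈ (c 0).F.support, (c 0).r ≤ e) (hfloor : ∀ k, ordZero (c k).F ≠ p) {k₀ d : ℕ}
    (hshade : ∀ k, k₀ ≤ k → (c k).shade = (d : ℕ∞)) {a a' : Fin 4} (haa : a ≠ a')
    (hcorner : ∀ k, k₀ ≤ k → b k = 0) (hletters : ∀ k, k₀ ≤ k → (j k = a ∨ j k = a'))
    (hfree : ∀ k, k₀ ≤ k → ∀ μ ∈ (resForm (c k)).support, μ a = 0 ∧ μ a' = 0)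
    (hlight : ∀ k, k₀ ≤ k → (c k).r a + (c k).r a' ≤ 2 * (c (k + 1)).r (j k)) : False := by
  refine no_pureCorner_frame_chain p (c := fun k => c (k₀ + k)) (j := fun k => j (k₀ + k))
    (b := fun k => b (k₀ + k)) (fun k => ?_) (fun k => ?_)
    (IsolatedBand.isolated_chain_forall_le hc hr0 k₀) (fun k => hfloor (k₀ + k))
    (fun k => hshade (k₀ + k) (Nat.le_add_right k₀ k)) haa (fun k => hcorner (k₀ + k) (Nat.le_add_right k₀ k))
    (fun k => hletters (k₀ + k) (Nat.le_add_right k₀ k)) (fun k => hfree (k₀ + k) (Nat.le_add_right k₀ k))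
    (fun k => ?_)
  · have := hc (k₀ + k)
    rwa [show k₀ + k + 1 = k₀ + (k + 1) by ring] at this
  · have := hw (k₀ + k)
    rwa [show k₀ + k + 1 = k₀ + (k + 1) by ring] at this
  · have := hlight (k₀ + k) (Nat.le_add_right k₀ k)
    rwa [show k₀ + k + 1 = k₀ + (k + 1) by ring] at this

end Chain

end ResCone

end Summit.ResolutionOfSingularities.ResolutionOfSingularities.Theorems.PIDim4

end
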